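import Mathlib
import Literature.NumberTheory.Transcendental.KZCalculusProofs
import Literature.NumberTheory.Transcendental.KZLogCalculusProofs
import Literature.NumberTheory.Transcendental.KZSemialgebraicComplex
import Literature.NumberTheory.Transcendental.KZIdealTetrahedron
import Literature.NumberTheory.Transcendental.KZIntervalPeriodProofs
import Summits.KontsevichZagierPeriods.KontsevichZagierPeriods.Theorems.HyperbolicBlochOffTetraSectorKernelStubAbelFiveTerm
import Summits.KontsevichZagierPeriods.KontsevichZagierPeriods.Theorems.HyperbolicBlochOffTetraSectorKernelStubRogersLogIdentity
import Summits.KontsevichZagierPeriods.KontsevichZagierPeriods.Theorems.HyperbolicBlochOffTetraSectorKernelStubCarrierExistence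
import Summits.KontsevichZagierPeriods.KontsevichZagierPeriods.Theorems.HyperbolicBlochOffTetraSectorKernelRogersReflection
import Summits.KontsevichZagierPeriods.KontsevichZagierPeriods.Theorems.MzvKernelInKZ.Negative.ScalingDivision

/-!
# `OffTetraSectorKernel` (stmt-KontsevichZagierPeriods-10557), line `odd-hyperbolic-ladder` (v9): THE REAL BLOCH GROUP INSIDE THE CALCULUS

The route's sector is the COMPLEX five-term relation (Bloch–Wigner function, ideal tetrahedra). Off the
sector the oracle is blind (`D ≡ 0` on `ℝ`); the weight-two real layer of the residue is spanned by the real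
dilogarithms of real algebraic arguments. With the ROGERS CARRIER
`R(a) := 2·[T a] + [N(1/a, 1/(1−a))]`, `T a = [{0<t<u<a}, 1/(u(1−t))]` (value `Li₂(a)`),
`N(a,b) = [(1,a)×(1,b), 1/(uw)]` (value `log a · log b`) — value `2Li₂(a) + log a·log(1−a) = 2L(a)`,
`L` = Rogers' dilogarithm — this file proves:

* `rogersFiveTerm_mem_relations` — ROGERS' FIVE-TERM EQUATION `R(x)+R(y)−R(xy)−R(X)−R(Y) ∈ relations`
  (`X = x(1−y)/(1−xy)`, `Y = y(1−x)/(1−xy)`, `0 < x, y < 1` real algebraic): Abel's equation inside the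
  calculus (`stub_abelFiveTerm`) twice, plus the logarithmic identity of the normalisation
  (`stub_rogersLogIdentity`, a polynomial identity in the formal period ring);
* `rogersReflection_mem_relations` — `R(x) + R(1−x) − 2R(½) ∈ relations` (Euler's reflection,
  `stub_eulerReflection`, with the log rectangles moved onto Euler's by `stub_logRectInvert`);
* `rogersRelators_closure_le_relations` — THE TRANSFER: the subgroup generated by all these real
  five-term and reflection relators lies in `KZ.relations` — every relation of the REAL PRE-BLOCH GROUP
  of `ℚ̄ ∩ (0,1)` is a chain of Kontsevich–Zagier moves (the real twin of the route's `FiveTermTransfer`);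
* `rogersSector_of_injectivity` — THE REAL TWIN OF `TetraSector`: IF every `ℤ`-relation among Rogers
  values `2L(aᵢ)`, `aᵢ ∈ ℚ̄ ∩ (0,1)`, is, up to an integer multiple, a consequence of five-term and
  reflection instances inside `(0,1)` ("real Rogers injectivity": injectivity of the real regulator on the
  pre-Bloch group of `ℚ̄ ∩ ℝ` modulo torsion — by Borel–Suslin the rank of `B(F)` is `r₂(F)`, so this is a
  statement about the Bloch–Wigner values at the OTHER embeddings of the real numbers `aᵢ`: the first place
  where the crux's own oracle re-enters off the sector), THEN every value-relator of Rogers carriers is a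
  KZ relation (integer division being a derived rule: `mem_relations_of_nsmul_mem`).

This NAMES the weight-two real layer of the crux's residue: it is `B(ℚ̄ ∩ ℝ) ⊗ ℚ`, exactly as the sector
is `B(ℚ̄)⁻ ⊗ ℚ`.

References: L. J. Rogers, *On function sum theorems connected with the series Σ xⁿ/n²*, Proc. LMS (2) 4
(1907) 169–189; D. Zagier, *The dilogarithm function* (2007), §I.2 and §II.1; A. Suslin, *K₃ of a field and
the Bloch group* (1991); M. Kontsevich, D. Zagier, *Periods* (2001), §1.2.
-/

noncomputable section

open Set MeasureTheory
open Literature.NumberTheory.Transcendental Literature.ModelTheory.ExponentialFields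

namespace Summit.KontsevichZagierPeriods.HyperbolicBloch.OffTetraSectorKernel

/-! ### Rogers' five-term equation -/

/-- **ROGERS' FIVE-TERM EQUATION INSIDE THE CALCULUS.** For real algebraic `0 < x, y < 1` and ANY choice of
the carriers, with `R(a) = 2[T a] + [N(1/a, 1/(1−a))]` (value `2 L(a)`, `L` Rogers' dilogarithm):
`R(x) + R(y) − R(xy) − R(x(1−y)/(1−xy)) − R(y(1−x)/(1−xy)) ∈ KZ.relations` — no logarithmic term. It is
`2 ·` Abel's equation (`stub_abelFiveTerm`) plus the logarithmic identity of the normalisation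
(`stub_rogersLogIdentity`), the auxiliary log rectangle `M = N((1−xy)/(1−x), (1−xy)/(1−y))` cancelling.
[cite: KontsevichZagier2001, §1.2] -/
theorem rogersFiveTerm_mem_relations :
    ∀ (x y : ℝ), IsAlgebraic ℚ x → IsAlgebraic ℚ y → 0 < x → x < 1 → 0 < y → y < 1 →
    ∀ (Lx Ly Lxy LX LY N₁ N₂ N₃ N₄ N₅ : KZ.IntegralRep 2),
      Lx.domain = {w | 0 < w 1 ∧ w 1 < w 0 ∧ w 0 < x} →
      Set.EqOn Lx.integrand (fun w => 1 / (w 0 * (1 - w 1))) Lx.domain →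
      Ly.domain = {w | 0 < w 1 ∧ w 1 < w 0 ∧ w 0 < y} →
      Set.EqOn Ly.integrand (fun w => 1 / (w 0 * (1 - w 1))) Ly.domain →
      Lxy.domain = {w | 0 < w 1 ∧ w 1 < w 0 ∧ w 0 < x * y} →
      Set.EqOn Lxy.integrand (fun w => 1 / (w 0 * (1 - w 1))) Lxy.domain →
      LX.domain = {w | 0 < w 1 ∧ w 1 < w 0 ∧ w 0 < x * (1 - y) / (1 - x * y)} →
      Set.EqOn LX.integrand (fun w => 1 / (w 0 * (1 - w 1))) LX.domain →
      LY.domain = {w | 0 < w 1 ∧ w 1 < w 0 ∧ w 0 < y * (1 - x) / (1 - x * y)} →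
      Set.EqOn LY.integrand (fun w => 1 / (w 0 * (1 - w 1))) LY.domain →
      N₁.domain = {w | 1 < w 0 ∧ w 0 < 1 / x ∧ 1 < w 1 ∧ w 1 < 1 / (1 - x)} →
      Set.EqOn N₁.integrand (fun w => 1 / (w 0 * w 1)) N₁.domain →
      N₂.domain = {w | 1 < w 0 ∧ w 0 < 1 / y ∧ 1 < w 1 ∧ w 1 < 1 / (1 - y)} →
      Set.EqOn N₂.integrand (fun w => 1 / (w 0 * w 1)) N₂.domain →
      N₃.domain = {w | 1 < w 0 ∧ w 0 < 1 / (x * y) ∧ 1 < w 1 ∧ w 1 < 1 / (1 - x * y)} →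
      Set.EqOn N₃.integrand (fun w => 1 / (w 0 * w 1)) N₃.domain →
      N₄.domain = {w | 1 < w 0 ∧ w 0 < 1 / (x * (1 - y) / (1 - x * y)) ∧ 1 < w 1 ∧
        w 1 < 1 / (1 - x * (1 - y) / (1 - x * y))} →
      Set.EqOn N₄.integrand (fun w => 1 / (w 0 * w 1)) N₄.domain →
      N₅.domain = {w | 1 < w 0 ∧ w 0 < 1 / (y * (1 - x) / (1 - x * y)) ∧ 1 < w 1 ∧
        w 1 < 1 / (1 - y * (1 - x) / (1 - x * y))} →
      Set.EqOn N₅.integrand (fun w => 1 / (w 0 * w 1)) N₅.domain →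
      ((2 : ℕ) • KZ.of Lx + KZ.of N₁) + ((2 : ℕ) • KZ.of Ly + KZ.of N₂) - ((2 : ℕ) • KZ.of Lxy + KZ.of N₃) -
        ((2 : ℕ) • KZ.of LX + KZ.of N₄) - ((2 : ℕ) • KZ.of LY + KZ.of N₅) ∈ KZ.relations := by
  intro x y hx hy hx0 hx1 hy0 hy1 Lx Ly Lxy LX LY N₁ N₂ N₃ N₄ N₅ hLx hLxi hLy hLyi hLxy hLxyi hLX hLXi hLY hLYi
    hN₁ hN₁i hN₂ hN₂i hN₃ hN₃i hN₄ hN₄i hN₅ hN₅i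
  have hP : IsAlgebraic ℚ ((1 - x * y) / (1 - x)) :=
    (isAlgebraic_one.sub (hx.mul hy)).mul (isAlgebraic_one.sub hx).inv
  have hQ : IsAlgebraic ℚ ((1 - x * y) / (1 - y)) :=
    (isAlgebraic_one.sub (hx.mul hy)).mul (isAlgebraic_one.sub hy).inv
  have hP1 : 1 ≤ (1 - x * y) / (1 - x) := by rw [le_div_iff₀ (by linarith)]; nlinarith
  have hQ1 : 1 ≤ (1 - x * y) / (1 - y) := by rw [le_div_iff₀ (by linarith)]; nlinarith
  obtain ⟨M, hMd, hMi⟩ := stub_logRectExists _ _ hP hQ hP1 hQ1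
  have hA := stub_abelFiveTerm x y hx hy hx0 hx1 hy0 hy1 Lx Ly Lxy LX LY M hLx hLxi hLy hLyi hLxy hLxyi
    hLX hLXi hLY hLYi hMd (fun w _ => by rw [hMi])
  have hR := stub_rogersLogIdentity x y hx hy hx0 hx1 hy0 hy1 N₁ N₂ N₃ N₄ N₅ M hN₁ hN₁i hN₂ hN₂i hN₃
    hN₃i hN₄ hN₄i hN₅ hN₅i hMd (fun w _ => by rw [hMi])
  have : ((2 : ℕ) • KZ.of Lx + KZ.of N₁) + ((2 : ℕ) • KZ.of Ly + KZ.of N₂) - ((2 : ℕ) • KZ.of Lxy + KZ.of N₃) -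
      ((2 : ℕ) • KZ.of LX + KZ.of N₄) - ((2 : ℕ) • KZ.of LY + KZ.of N₅) =
      (2 : ℕ) • (KZ.of Lx + KZ.of Ly - KZ.of Lxy - KZ.of LX - KZ.of LY - KZ.of M) +
      (KZ.of N₁ + KZ.of N₂ - KZ.of N₃ - KZ.of N₄ - KZ.of N₅ + (2 : ℕ) • KZ.of M) := by abel
  rw [this]
  exact KZ.relations.add_mem (KZ.relations.nsmul_mem hA 2) hR

/-- **Rogers carriers exist** for every real algebraic `0 < a < 1` (`stub_dilogCarrierExists`,
`stub_logRectExists` with `1/a, 1/(1−a) ≥ 1`). [cite: KontsevichZagier2001, §1.1] -/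
theorem exists_rogersCarrier {a : ℝ} (ha : IsAlgebraic ℚ a) (ha0 : 0 < a) (ha1 : a < 1) :
    ∃ L N : KZ.IntegralRep 2, (L.domain = {w | 0 < w 1 ∧ w 1 < w 0 ∧ w 0 < a} ∧
      L.integrand = fun w => 1 / (w 0 * (1 - w 1))) ∧
      (N.domain = {w | 1 < w 0 ∧ w 0 < 1 / a ∧ 1 < w 1 ∧ w 1 < 1 / (1 - a)} ∧
      N.integrand = fun w => 1 / (w 0 * w 1)) := by
  obtain ⟨L, hL⟩ := stub_dilogCarrierExists a ha ha0 ha1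
  obtain ⟨N, hN⟩ := stub_logRectExists (1 / a) (1 / (1 - a)) (by simpa using ha.inv)
    (by simpa using (isAlgebraic_one.sub ha).inv) (by rw [le_div_iff₀ ha0]; linarith) (by rw [le_div_iff₀ (by linarith)]; linarith)
  exact ⟨L, N, hL, hN⟩

/-! ### The real twin of `TetraSector`: the Rogers sector closes GIVEN real Rogers injectivity -/

/-- **THE ROGERS SECTOR, GIVEN REAL ROGERS INJECTIVITY** (the real twin of the route's `TetraSector`).
HYPOTHESIS (`hinj`, "real Rogers injectivity"; the real counterpart of Zagier's conjecture, NOT claimed):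
every `ℤ`-relation `Σ nᵢ · 2L(aᵢ) = 0` among Rogers values of real algebraic `aᵢ ∈ (0,1)` (written as
integrals over the carriers' domains) is, up to a positive integer multiple, a consequence of the five-term
and reflection instances with entries in `(0,1)`, i.e. `N · Σ nᵢ [aᵢ]` lies in the subgroup of
`FreeAbelianGroup ℝ` generated by `[x]+[y]−[xy]−[x(1−y)/(1−xy)]−[y(1−x)/(1−xy)]` and `[x]+[1−x]−2[½]`.
CONCLUSION: for EVERY family of Rogers carriers `R(a) = 2[L a] + [N a]` and every such value-relator,
`Σ nᵢ • R(aᵢ) ∈ KZ.relations`. Proof: the additive map `[a] ↦ R(a)` (zero off `ℚ̄ ∩ (0,1)`) sends both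
kinds of generators into `relations` (`rogersFiveTerm_mem_relations`, `rogersReflection_mem_relations`), hence the generated subgroup; then
divide by `N` (`mem_relations_of_nsmul_mem`).
[cite: KontsevichZagier2001, §1.2] -/
theorem rogersSector_of_injectivity
    (hinj : ∀ (k : ℕ) (a : Fin k → ℝ) (n : Fin k → ℤ), (∀ i, IsAlgebraic ℚ (a i)) →
      (∀ i, 0 < a i ∧ a i < 1) →
      ∑ i, (n i : ℝ) * (2 * (∫ w in {w : Fin 2 → ℝ | 0 < w 1 ∧ w 1 < w 0 ∧ w 0 < a i},
          1 / (w 0 * (1 - w 1))) +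
        ∫ w in {w : Fin 2 → ℝ | 1 < w 0 ∧ w 0 < 1 / a i ∧ 1 < w 1 ∧ w 1 < 1 / (1 - a i)},
          1 / (w 0 * w 1)) = 0 →
      ∃ N : ℕ, 0 < N ∧ N • (∑ i, n i • FreeAbelianGroup.of (a i)) ∈
        AddSubgroup.closure ({c : FreeAbelianGroup ℝ | ∃ x y : ℝ, IsAlgebraic ℚ x ∧ IsAlgebraic ℚ y ∧
            0 < x ∧ x < 1 ∧ 0 < y ∧ y < 1 ∧ c = FreeAbelianGroup.of x + FreeAbelianGroup.of y -
              FreeAbelianGroup.of (x * y) - FreeAbelianGroup.of (x * (1 - y) / (1 - x * y)) -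
              FreeAbelianGroup.of (y * (1 - x) / (1 - x * y))} ∪
          {c | ∃ x : ℝ, IsAlgebraic ℚ x ∧ 0 < x ∧ x < 1 ∧ c = FreeAbelianGroup.of x +
            FreeAbelianGroup.of (1 - x) - (2 : ℕ) • FreeAbelianGroup.of (1 / 2 : ℝ)}))
    (L N : ℝ → KZ.IntegralRep 2)
    (hL : ∀ a, IsAlgebraic ℚ a → 0 < a → a < 1 → (L a).domain = {w | 0 < w 1 ∧ w 1 < w 0 ∧ w 0 < a} ∧
      EqOn (L a).integrand (fun w => 1 / (w 0 * (1 - w 1))) (L a).domain)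
    (hN : ∀ a, IsAlgebraic ℚ a → 0 < a → a < 1 →
      (N a).domain = {w | 1 < w 0 ∧ w 0 < 1 / a ∧ 1 < w 1 ∧ w 1 < 1 / (1 - a)} ∧
      EqOn (N a).integrand (fun w => 1 / (w 0 * w 1)) (N a).domain) :
    ∀ (k : ℕ) (a : Fin k → ℝ) (n : Fin k → ℤ), (∀ i, IsAlgebraic ℚ (a i)) → (∀ i, 0 < a i ∧ a i < 1) →
      ∑ i, (n i : ℝ) * (2 * (L (a i)).value + (N (a i)).value) = 0 →
      ∑ i, n i • ((2 : ℕ) • KZ.of (L (a i)) + KZ.of (N (a i))) ∈ KZ.relations := by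
  classical
  intro k a n halg hrange hval
  -- the transfer map `[a] ↦ R(a)` (zero off `ℚ̄ ∩ (0,1)`)
  let ρ : ℝ → KZ.FormalRep := fun a =>
    if IsAlgebraic ℚ a ∧ 0 < a ∧ a < 1 then (2 : ℕ) • KZ.of (L a) + KZ.of (N a) else 0
  let Φ : FreeAbelianGroup ℝ →+ KZ.FormalRep := FreeAbelianGroup.lift ρ
  have hρ : ∀ a, IsAlgebraic ℚ a → 0 < a → a < 1 → Φ (FreeAbelianGroup.of a) = (2 : ℕ) • KZ.of (L a) + KZ.of (N a) := by
    intro a ha h0 h1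
    simp only [Φ, FreeAbelianGroup.lift_apply_of, ρ]
    exact if_pos ⟨ha, h0, h1⟩
  -- generators go to relations
  have hgen : AddSubgroup.closure ({c : FreeAbelianGroup ℝ | ∃ x y : ℝ, IsAlgebraic ℚ x ∧ IsAlgebraic ℚ y ∧
        0 < x ∧ x < 1 ∧ 0 < y ∧ y < 1 ∧ c = FreeAbelianGroup.of x + FreeAbelianGroup.of y -
          FreeAbelianGroup.of (x * y) - FreeAbelianGroup.of (x * (1 - y) / (1 - x * y)) -
          FreeAbelianGroup.of (y * (1 - x) / (1 - x * y))} ∪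
      {c | ∃ x : ℝ, IsAlgebraic ℚ x ∧ 0 < x ∧ x < 1 ∧ c = FreeAbelianGroup.of x +
        FreeAbelianGroup.of (1 - x) - (2 : ℕ) • FreeAbelianGroup.of (1 / 2 : ℝ)}) ≤ KZ.relations.comap Φ := by
    rw [AddSubgroup.closure_le]
    rintro c (⟨x, y, hx, hy, hx0, hx1, hy0, hy1, rfl⟩ | ⟨x, hx, hx0, hx1, rfl⟩)
    · have hxy : IsAlgebraic ℚ (x * y) := hx.mul hy
      have hxy0 : 0 < x * y := mul_pos hx0 hy0
      have hxy1 : x * y < 1 := by nlinarith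
      have hden : 0 < 1 - x * y := by nlinarith
      have hX : IsAlgebraic ℚ (x * (1 - y) / (1 - x * y)) :=
        (hx.mul (isAlgebraic_one.sub hy)).mul (isAlgebraic_one.sub (hx.mul hy)).inv
      have hY : IsAlgebraic ℚ (y * (1 - x) / (1 - x * y)) :=
        (hy.mul (isAlgebraic_one.sub hx)).mul (isAlgebraic_one.sub (hx.mul hy)).inv
      have hX0 : 0 < x * (1 - y) / (1 - x * y) := div_pos (mul_pos hx0 (by linarith)) hden
      have hX1 : x * (1 - y) / (1 - x * y) < 1 := by rw [div_lt_one hden]; nlinarith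
      have hY0 : 0 < y * (1 - x) / (1 - x * y) := div_pos (mul_pos hy0 (by linarith)) hden
      have hY1 : y * (1 - x) / (1 - x * y) < 1 := by rw [div_lt_one hden]; nlinarith
      simp only [SetLike.mem_coe, AddSubgroup.mem_comap, map_sub, map_add, hρ x hx hx0 hx1, hρ y hy hy0 hy1,
        hρ _ hxy hxy0 hxy1, hρ _ hX hX0 hX1, hρ _ hY hY0 hY1]
      exact rogersFiveTerm_mem_relations x y hx hy hx0 hx1 hy0 hy1 _ _ _ _ _ _ _ _ _ _ (hL x hx hx0 hx1).1
        (hL x hx hx0 hx1).2 (hL y hy hy0 hy1).1 (hL y hy hy0 hy1).2 (hL _ hxy hxy0 hxy1).1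
        (hL _ hxy hxy0 hxy1).2 (hL _ hX hX0 hX1).1 (hL _ hX hX0 hX1).2 (hL _ hY hY0 hY1).1
        (hL _ hY hY0 hY1).2 (hN x hx hx0 hx1).1 (hN x hx hx0 hx1).2 (hN y hy hy0 hy1).1 (hN y hy hy0 hy1).2
        (hN _ hxy hxy0 hxy1).1 (hN _ hxy hxy0 hxy1).2 (hN _ hX hX0 hX1).1 (hN _ hX hX0 hX1).2
        (hN _ hY hY0 hY1).1 (hN _ hY hY0 hY1).2
    · have h1x : IsAlgebraic ℚ (1 - x) := isAlgebraic_one.sub hx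
      have hh : IsAlgebraic ℚ (1 / 2 : ℝ) := by
        rw [show (1 / 2 : ℝ) = ((1 / 2 : ℚ) : ℝ) by push_cast; ring]; exact isAlgebraic_algebraMap _
      simp only [SetLike.mem_coe, AddSubgroup.mem_comap, map_sub, map_add, map_nsmul, hρ x hx hx0 hx1,
        hρ (1 - x) h1x (by linarith) (by linarith), hρ (1 / 2) hh (by norm_num) (by norm_num)]
      have hh0 : (0 : ℝ) < 1 / 2 := by norm_num
      have hh1 : (1 / 2 : ℝ) < 1 := by norm_num
      exact rogersReflection_mem_relations x hx hx0 hx1 (L x) (L (1 - x)) (L (1 / 2)) (N x) (N (1 - x)) (N (1 / 2))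
        (hL x hx hx0 hx1).1 (hL x hx hx0 hx1).2 (hL (1 - x) h1x (by linarith) (by linarith)).1
        (hL (1 - x) h1x (by linarith) (by linarith)).2 (hL (1 / 2) hh hh0 hh1).1 (hL (1 / 2) hh hh0 hh1).2
        (hN x hx hx0 hx1).1 (hN x hx hx0 hx1).2 (hN (1 - x) h1x (by linarith) (by linarith)).1
        (hN (1 - x) h1x (by linarith) (by linarith)).2 (hN (1 / 2) hh hh0 hh1).1 (hN (1 / 2) hh hh0 hh1).2
  -- the value hypothesis in integral form
  have hval' : ∑ i, (n i : ℝ) * (2 * (∫ w in {w : Fin 2 → ℝ | 0 < w 1 ∧ w 1 < w 0 ∧ w 0 < a i},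
        1 / (w 0 * (1 - w 1))) +
      ∫ w in {w : Fin 2 → ℝ | 1 < w 0 ∧ w 0 < 1 / a i ∧ 1 < w 1 ∧ w 1 < 1 / (1 - a i)},
        1 / (w 0 * w 1)) = 0 := by
    have hsum : ∑ i, (n i : ℝ) * (2 * (∫ w in {w : Fin 2 → ℝ | 0 < w 1 ∧ w 1 < w 0 ∧ w 0 < a i},
          1 / (w 0 * (1 - w 1))) +
        ∫ w in {w : Fin 2 → ℝ | 1 < w 0 ∧ w 0 < 1 / a i ∧ 1 < w 1 ∧ w 1 < 1 / (1 - a i)},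
          1 / (w 0 * w 1)) = ∑ i, (n i : ℝ) * (2 * (L (a i)).value + (N (a i)).value) := by
      refine Finset.sum_congr rfl fun i _ => ?_
      obtain ⟨hLd, hLi⟩ := hL (a i) (halg i) (hrange i).1 (hrange i).2
      obtain ⟨hNd, hNi⟩ := hN (a i) (halg i) (hrange i).1 (hrange i).2
      have hLm : MeasurableSet (L (a i)).domain := KZ.IntegralRep.measurableSet_domain_holds _
      have hNm : MeasurableSet (N (a i)).domain := KZ.IntegralRep.measurableSet_domain_holds _
      have e1 : (∫ w in {w : Fin 2 → ℝ | 0 < w 1 ∧ w 1 < w 0 ∧ w 0 < a i}, 1 / (w 0 * (1 - w 1))) =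
          (L (a i)).value := by
        rw [KZ.IntegralRep.value, ← hLd]
        exact (setIntegral_congr_fun hLm hLi).symm
      have e2 : (∫ w in {w : Fin 2 → ℝ | 1 < w 0 ∧ w 0 < 1 / a i ∧ 1 < w 1 ∧ w 1 < 1 / (1 - a i)},
          1 / (w 0 * w 1)) = (N (a i)).value := by
        rw [KZ.IntegralRep.value, ← hNd]
        exact (setIntegral_congr_fun hNm hNi).symm
      rw [e1, e2]
    rw [hsum]
    exact hval
  obtain ⟨M, hM0, hMmem⟩ := hinj k a n halg hrange hval'
  have hΦ : Φ (M • ∑ i, n i • FreeAbelianGroup.of (a i)) ∈ KZ.relations := hgen hMmem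
  rw [map_nsmul, map_sum] at hΦ
  have hsum : ∑ i, Φ (n i • FreeAbelianGroup.of (a i)) = ∑ i, n i • ((2 : ℕ) • KZ.of (L (a i)) + KZ.of (N (a i))) :=
    Finset.sum_congr rfl fun i _ => by rw [map_zsmul, hρ (a i) (halg i) (hrange i).1 (hrange i).2]
  rw [hsum] at hΦ
  exact Summit.KontsevichZagierPeriods.MzvKernelInKZ.Negative.mem_relations_of_nsmul_mem
    hM0 hΦ

end Summit.KontsevichZagierPeriods.HyperbolicBloch.OffTetraSectorKernel

end
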